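import Literature.NumberTheory.Weil1964.UnitaryArchSingularTopFormFamilyQuotient      -- ★ A-p19 (g21): `archSingularTopFormFamily`, `centralizerTopFormHaar`, `exists_atPoint_archSingularTopFormFamily_eq`
import Literature.NumberTheory.Weil1964.UnitaryArchSingularCentralizerTopFormHaarCoherence   -- ★ `isHaarMeasure_centralizerTopFormHaar`, `isInvInvariant_centralizerTopFormHaar`
import Literature.NumberTheory.Automorphic.UnitaryGroupDiagTraceExplicitWeights        -- ★ `quotientMeasure_eq_inv_smul_of_eq_smul` (`dν ∕ d(c·ρ) = c⁻¹ · dν ∕ dρ`)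
import HarnessLib

/-!
# (J-val-K) «THE BUILT SINGULAR TORUS DATUM IS A CONSTANT MULTIPLE OF THE TOP-FORM DATUM» — the ONE named hypothesis of the (K7-s) assembly for the built (ST-∞)
# witness, and what it buys: the built singular members are `K⁻¹ ×` the top-form members (Rogawski 1990 §1.7 p. 6, §4.3 (4.3.1) p. 43, §8.2 pp. 119–124, §14.5 p. 239)

Topic `NumberTheory/Rogawski1990`.  THEOREMS ONLY (no definition, no instance, no notation, no named fact, no `sorry`).  Cell `pub/hodgecm-mathlib`, ENGINE T1, crux H413 =
`stmt-HodgeConjecture-24833` (supports-only).  LEAD F0P3a-plan (g10) WORD T9-19 (2) ((R2) of census `CENSUS-Jval-ArchCovolumeRatio.F0P3p03g10` cbbd319c, MEMO `MEMO-PinI-vs-K7s`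
34819fba, WORD T9-15 (4)): the printed VALUE (J-val) «for compatible measures the singular constants at `γ₀`, `γ₀′` agree up to the sign `e(γ₀) = 1, e(γ₀′) = −1`» [Rogawski1990
§8.2 pp. 119–124, §1.7 p. 6] enters the built (ST-∞) witness (pin (i): probability at compact walls, (J-nc) constant `−1` at noncompact walls; ★ p843599 (W3-pins), ★ p843611 (W4c))
EXACTLY ONCE, in the archimedean factor of (K7-s) [§14.5 p. 239; Kottwitz1988 Prop. 2], and in exactly this GLOBAL shape:

  **(J-val-K)  `∃ K : ℝ≥0, K ≠ 0 ∧ ∀ γ, P γ → Ts γ = K • centralizerTopFormHaar L H γ`**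

(`Ts` the witness's torus datum on `U(H)(L⁺ ⊗ ℝ)`, `P` its wall-class guard, `centralizerTopFormHaar` ★ A-p19's top-form («compatible», [§1.7 p. 6]) centraliser measure of the D-T
road).  It is a HYPOTHESIS of the (K7-s) assembly (like (K7-s) itself), not a Literature fact (it speaks about our construction); its discharge = per-place top-form factors (D-T road)
+ the printed per-place identity `c_w(|ω′|) = −vol_{|ω|}(U(2)×U(1)(ℝ))` (census §1–§2).  Count-neutral.  HONEST LABEL: HC_CM is proved only modulo the printed citations until rung 0
closes; this file pays nothing by itself — it NAMES the hypothesis and proves what the (K7-s) assembly reads from it.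

* §1 (generic, any locally compact second countable `G`): **`OrbitalMeasureFamily.IsQuotientOf.atPoint_eq_inv_smul_quotientMeasure_of_eq_smul`** — for a Weil-quotient family
  `m` of `ν` by a torus datum `t` coherent on a conjugation-stable guard `P`, and `t = K • t′` on `P` (`K ≠ 0`, `t′` Haar inversion-invariant there): at every `P`-point
  `m.atPoint γ = K⁻¹ • (dν ∕ dt′_γ)` (★ `IsQuotientOf.atPoint_eq_quotientMeasure_of_forall_map_conj_eq` + ★ `quotientMeasure_eq_inv_smul_of_eq_smul`).
* §2 (`U(H)(L⁺ ⊗ ℝ)`, `t′ := centralizerTopFormHaar L H`): **`atPoint_eq_inv_smul_topFormFamily_of_pinRatio`** — under (J-val-K) (binder `hK`, VERBATIM above) the built member at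
  every framed `P`-point is `K⁻¹ •` the Weil quotient by the top-form datum, `= K⁻¹ • (archSingularTopFormFamily L H ν).atPoint γ` (★ `exists_atPoint_archSingularTopFormFamily_eq`):
  the adelic centraliser measures the built witness induces are `K •` the top-form ones at `∞`, with ONE `K` for all (stably conjugate) singular classes — so the covolume identity
  (K7-s) for the built witness is the D-T road's covolume identity for the top-form witness.

## References
* [Rogawski1990] J. D. Rogawski, *Automorphic Representations of Unitary Groups in Three Variables*, Ann. of Math. Stud. 123 (1990), §1.7 p. 6; §4.3 (4.3.1) p. 43; §8.2
  pp. 119–124; §14.5 Lemma 14.5.2 (b) p. 239.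
* [DeitmarEchterhoff2014] A. Deitmar, S. Echterhoff, *Principles of Harmonic Analysis*, 2nd ed. (2014), Thm. 1.5.3 (invariant quotient measure; uniqueness up to a scalar).
* [Kottwitz1988] R. E. Kottwitz, *Tamagawa numbers*, Ann. of Math. 127 (1988), Prop. 2 (compatible measures across inner forms).
-/

set_option autoImplicit false

noncomputable section

open MeasureTheory Measure Set NumberField NumberField.InfinitePlace NumberField.mixedEmbedding
open Literature.MeasureTheory.Group Literature.NumberTheory.Automorphic Literature.NumberTheory.Automorphic.UnitaryGroup
open Literature.NumberTheory.Weil1964 Literature.NumberTheory.Weil1964.UnitaryArchTopForm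
open scoped ENNReal NNReal Classical MatrixGroups

/-! ## §1 Generic: a datum that is a constant multiple of another -/

namespace Literature.NumberTheory.Automorphic

section Generic

variable {G : Type*} [Group G] [TopologicalSpace G] [IsTopologicalGroup G] [LocallyCompactSpace G]
  [SecondCountableTopology G] [T2Space G] [MeasurableSpace G] [BorelSpace G]
  [∀ γ : G, MeasurableSpace (G ⧸ Subgroup.centralizer ({γ} : Set G))]
  [∀ γ : G, BorelSpace (G ⧸ Subgroup.centralizer ({γ} : Set G))]

/-- **`t = K • t′` ON THE GUARD ⟹ THE MEMBERS ARE `K⁻¹ •` THE WEIL QUOTIENTS BY `t′`.**  For `m` the Weil-quotient family of `ν` by a torus datum `t` coherent under conjugation on a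
conjugation-stable guard `P` (★ `IsQuotientOf.atPoint_eq_quotientMeasure_of_forall_map_conj_eq`), and `t γ = K • t′ γ` at every `P`-point with `K ≠ 0` and `t′ γ` Haar and
inversion invariant: `m.atPoint γ = K⁻¹ • dν ∕ dt′_γ` (★ `quotientMeasure_eq_inv_smul_of_eq_smul`: `dν ∕ d(K·ρ) = K⁻¹ · dν ∕ dρ`).
[cite: Rogawski1990, §1.7 p. 6; §4.3 (4.3.1) p. 43] [cite: DeitmarEchterhoff2014, Thm. 1.5.3] -/
theorem OrbitalMeasureFamily.IsQuotientOf.atPoint_eq_inv_smul_quotientMeasure_of_eq_smul {P : G → Prop} {ν : Measure G} [ν.IsHaarMeasure]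
    [ν.IsMulRightInvariant] {t t' : ∀ γ : G, Measure (Subgroup.centralizer ({γ} : Set G))} {m : OrbitalMeasureFamily G}
    (h : m.IsQuotientOf P ν t) (hP : ∀ (γ₁ q : G), P γ₁ → P (q * γ₁ * q⁻¹))
    (hcoh : ∀ (γ₁ γ₂ q : G) (hq : (MulAut.conj q : G ≃* G) γ₁ = γ₂), P γ₁ →
      Measure.map (subgroupCongrHomeomorph (MulAut.conj q : G ≃* G) (Subgroup.centralizer ({γ₁} : Set G))
        (Subgroup.centralizer ({γ₂} : Set G)) (forall_apply_mem_centralizer_singleton_iff_of_eq (MulAut.conj q : G ≃* G) hq)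
        (continuous_mulAutConj q) (continuous_mulAutConj_symm q)) (t γ₁) = t γ₂)
    (K : ℝ≥0) (hK : K ≠ 0) (htt' : ∀ γ, P γ → t γ = K • t' γ)
    (ht' : ∀ γ, P γ → (t' γ).IsHaarMeasure ∧ (t' γ).IsInvInvariant)
    (γ : G) (hγ : P γ) :
    haveI := (ht' γ hγ).1
    haveI := (ht' γ hγ).2
    m.atPoint γ = K⁻¹ • quotientMeasure (Subgroup.centralizer ({γ} : Set G)) (t' γ) (isClosed_coe_centralizer_singleton γ) ν := by
  obtain ⟨h1, h2, h3⟩ := h.atPoint_eq_quotientMeasure_of_forall_map_conj_eq hP hcoh γ hγ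
  haveI := (ht' γ hγ).1
  haveI := (ht' γ hγ).2
  haveI := h1
  haveI := h2
  haveI hZc : IsClosed ((Subgroup.centralizer ({γ} : Set G) : Subgroup G) : Set G) := isClosed_coe_centralizer_singleton γ
  haveI : LocallyCompactSpace (Subgroup.centralizer ({γ} : Set G)) := hZc.isClosedEmbedding_subtypeVal.locallyCompactSpace
  haveI : SecondCountableTopology (Subgroup.centralizer ({γ} : Set G)) := TopologicalSpace.Subtype.secondCountableTopology _
  rw [h3]
  exact quotientMeasure_eq_inv_smul_of_eq_smul (hH := isClosed_coe_centralizer_singleton γ) (Subgroup.centralizer ({γ} : Set G)) ν (t' γ) (t γ) K hK (htt' γ hγ)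

end Generic

end Literature.NumberTheory.Automorphic

/-! ## §2 `U(H)(L⁺ ⊗ ℝ)`: the named hypothesis (J-val-K) and what the (K7-s) assembly reads from it -/

namespace Literature.NumberTheory.Rogawski1990

variable (L : Type) [Field L] [NumberField L] [IsCMField L] (H : Matrix (Fin 3) (Fin 3) L)
  [MeasurableSpace (arch (↥(maximalRealSubfield L)) L (IsCMField.complexConj L) 3 H)] [BorelSpace (arch (↥(maximalRealSubfield L)) L (IsCMField.complexConj L) 3 H)]
  [∀ γ : arch (↥(maximalRealSubfield L)) L (IsCMField.complexConj L) 3 H,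
    MeasurableSpace (arch (↥(maximalRealSubfield L)) L (IsCMField.complexConj L) 3 H ⧸
      Subgroup.centralizer ({γ} : Set (arch (↥(maximalRealSubfield L)) L (IsCMField.complexConj L) 3 H)))]
  [∀ γ : arch (↥(maximalRealSubfield L)) L (IsCMField.complexConj L) 3 H,
    BorelSpace (arch (↥(maximalRealSubfield L)) L (IsCMField.complexConj L) 3 H ⧸
      Subgroup.centralizer ({γ} : Set (arch (↥(maximalRealSubfield L)) L (IsCMField.complexConj L) 3 H)))]

/-- **(J-val-K) ⟹ THE BUILT SINGULAR MEMBERS ARE `K⁻¹ ×` THE TOP-FORM MEMBERS.**  Let `ms` be a Weil-quotient family of `ν` by a torus datum `Ts` on `U(H)(L⁺ ⊗ ℝ)` (★ (W4c)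
`exists_archSingularFamily_of_coherent_torusDatum` over ★ (W3-pins)), `Ts` coherent under conjugation on a conjugation-stable guard `P` all of whose points are framed (★
`IsSingularArchFrame`; the wall classes are).  Under the NAMED HYPOTHESIS **(J-val-K) `hK : ∃ K : ℝ≥0, K ≠ 0 ∧ ∀ γ, P γ → Ts γ = K • centralizerTopFormHaar L H γ`** — the ONE
line through which the printed value «compatible measures give matched singular constants» [§8.2 pp. 119–124, §1.7 p. 6] enters (K7-s) for the built witness — at every `P`-point:
`ms.atPoint γ = K⁻¹ • dν ∕ d(centralizerTopFormHaar γ) = K⁻¹ • (archSingularTopFormFamily L H ν).atPoint γ` (★ A-p19 `exists_atPoint_archSingularTopFormFamily_eq`).  Hence every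
adelic centraliser measure the built witness induces is `K •` the top-form one at `∞`, the SAME `K` for all singular classes: (K7-s) for the built witness ⟺ (K7-s) for the top-form
witness (the D-T road). [cite: Rogawski1990, §1.7 p. 6; §4.3 (4.3.1) p. 43; §8.2 pp. 119–124; §14.5 Lemma 14.5.2 (b) p. 239] [cite: DeitmarEchterhoff2014, Thm. 1.5.3] -/
theorem atPoint_eq_inv_smul_topFormFamily_of_pinRatio
    {P : arch (↥(maximalRealSubfield L)) L (IsCMField.complexConj L) 3 H → Prop}
    (hP : ∀ (γ₁ q : arch (↥(maximalRealSubfield L)) L (IsCMField.complexConj L) 3 H), P γ₁ → P (q * γ₁ * q⁻¹))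
    (hframe : ∀ γ, P γ → ∃ (a b : L) (T : GL (Fin 3) (mixedSpace L)) (H_a : Matrix (Fin 2) (Fin 2) L) (H_b : Matrix (Fin 1) (Fin 1) L), IsSingularArchFrame L H γ a b T H_a H_b)
    (ν : Measure (arch (↥(maximalRealSubfield L)) L (IsCMField.complexConj L) 3 H)) [ν.IsHaarMeasure] [ν.IsMulRightInvariant]
    {Ts : ∀ γ : arch (↥(maximalRealSubfield L)) L (IsCMField.complexConj L) 3 H,
      Measure (Subgroup.centralizer ({γ} : Set (arch (↥(maximalRealSubfield L)) L (IsCMField.complexConj L) 3 H)))}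
    {ms : OrbitalMeasureFamily (arch (↥(maximalRealSubfield L)) L (IsCMField.complexConj L) 3 H)}
    (hms : ms.IsQuotientOf P ν Ts)
    (hcoh : ∀ (γ₁ γ₂ q : arch (↥(maximalRealSubfield L)) L (IsCMField.complexConj L) 3 H)
      (hq : (MulAut.conj q : arch (↥(maximalRealSubfield L)) L (IsCMField.complexConj L) 3 H ≃* arch (↥(maximalRealSubfield L)) L (IsCMField.complexConj L) 3 H) γ₁ = γ₂), P γ₁ →
      Measure.map (subgroupCongrHomeomorph (MulAut.conj q : arch (↥(maximalRealSubfield L)) L (IsCMField.complexConj L) 3 H ≃* arch (↥(maximalRealSubfield L)) L (IsCMField.complexConj L) 3 H)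
        (Subgroup.centralizer ({γ₁} : Set _)) (Subgroup.centralizer ({γ₂} : Set _))
        (forall_apply_mem_centralizer_singleton_iff_of_eq (MulAut.conj q : arch (↥(maximalRealSubfield L)) L (IsCMField.complexConj L) 3 H ≃* arch (↥(maximalRealSubfield L)) L (IsCMField.complexConj L) 3 H) hq)
        (continuous_mulAutConj q) (continuous_mulAutConj_symm q)) (Ts γ₁) = Ts γ₂)
    -- ===== (J-val-K): THE NAMED HYPOTHESIS =====
    (hK : ∃ K : ℝ≥0, K ≠ 0 ∧ ∀ γ, P γ → Ts γ = K • centralizerTopFormHaar L H γ)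
    (γ : arch (↥(maximalRealSubfield L)) L (IsCMField.complexConj L) 3 H) (hγ : P γ) :
    ∃ (K : ℝ≥0) (_ : (centralizerTopFormHaar L H γ).IsHaarMeasure) (_ : (centralizerTopFormHaar L H γ).IsInvInvariant),
      K ≠ 0 ∧ (∀ γ', P γ' → Ts γ' = K • centralizerTopFormHaar L H γ') ∧
      ms.atPoint γ = K⁻¹ • quotientMeasure (Subgroup.centralizer ({γ} : Set _)) (centralizerTopFormHaar L H γ) (isClosed_coe_centralizer_singleton γ) ν ∧
      ms.atPoint γ = K⁻¹ • (archSingularTopFormFamily L H ν).atPoint γ := by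
  obtain ⟨K, hK0, hKt⟩ := hK
  have ht' : ∀ γ', P γ' → (centralizerTopFormHaar L H γ').IsHaarMeasure ∧ (centralizerTopFormHaar L H γ').IsInvInvariant := fun γ' hγ' => by
    obtain ⟨a, b, T, H_a, H_b, hf⟩ := hframe γ' hγ'
    exact ⟨isHaarMeasure_centralizerTopFormHaar hf, isInvInvariant_centralizerTopFormHaar hf⟩
  have h1 := hms.atPoint_eq_inv_smul_quotientMeasure_of_eq_smul hP hcoh K hK0 hKt ht' γ hγ
  obtain ⟨i1, i2, h2⟩ := exists_atPoint_archSingularTopFormFamily_eq L H ν γ (hframe γ hγ)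
  refine ⟨K, (ht' γ hγ).1, (ht' γ hγ).2, hK0, hKt, h1, ?_⟩
  rw [h1, h2]

end Literature.NumberTheory.Rogawski1990

end
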